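import Summits.Ventures.PercRepro.C041ZoneOCubeCountDefs
import Summits.Ventures.PercRepro.C041ZoneOneVertexDefs

/-!
# ROW C-041 — THE PENDANT ATTACHMENT of a zone at a vertex of an unmarked multigraph: the glued zone and its
reaches (p6, gen 29; mine-3's C-041.md §20 (b), THEOREM (PENDANT ZONE): the zone-side half)

`pendant Z₁ u Z₂ a₂` glues an UNMARKED multigraph `Z₁` (anchor `a`, any cycles) and a zone `Z₂` (anchor `a₂`, marks
anywhere, any cycles) by identifying `u ∈ Z₁` with `a₂`: the vertices are `V₁ ⊕ V₂`, every incidence of `a₂` is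
REDIRECTED to `inl u` (`red`), and `inr a₂` is a stray isolated unmarked vertex — no quotient.  A state of the glued
zone is a colouring `ω₁` of `Z₁` (`colL`) with a state of `Z₂` (`restr`).  The marks of the glued zone are those of
`Z₂` at their redirected positions (`inl_mem_Bl_iff`, `inr_mem_Bl_iff`, …), and EVERY REACH is read off the two
sides (`inl_mem_reach_iff`, `inr_mem_reach_iff`, for any colour and any source set avoiding the stray vertex): the
junction `inl u` is reached iff `u` is reached inside `Z₁` or `a₂` inside `Z₂` (`junction`); a `Z₁`-vertex is
reached iff reached inside `Z₁`, or connected to `u` with the junction reached; a `Z₂`-vertex likewise with `a₂`.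
Consequences, with `Mg` / `Rd` = «`u` merged into / reached by the anchor inside `Z₁`» (`C041ZoneOneVertexDefs`):
`inl a ∈ D ⟺ a₂ ∈ D₂ ∧ Mg`, `inl a ∈ D2 ⟺ a₂ ∈ D2₂ ∧ Mg`, `adm ⟺ adm₂`, `blueK {inl a} ⟺ (Rd → blueK₂ {a₂})`.
The counts and THEOREM (PENDANT ZONE) in its (P)-propagation form are in `C041PendantCounts`.
-/

namespace PercRepro

namespace ZoneZ

namespace Pendant

open ZoneData

universe u₁ u₂ u₃ u₄ u₅ u₆ u₇ u₈

variable {V₁ : Type u₁} {E₁ : Type u₂} {U₁ : Type u₃} {U₂ : Type u₄} {V₂ : Type u₅} {E₂ : Type u₆}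
  {T₁ : Type u₇} {T₂ : Type u₈}

/-! ## The glued zone -/

open Classical in
/-- The redirection of the vertices of `Z₂`: `a₂` becomes the junction `inl u`, every other vertex stays. -/
noncomputable def red (u : V₁) (a₂ : V₂) (x : V₂) : V₁ ⊕ V₂ := if x = a₂ then Sum.inl u else Sum.inr x

/-- The anchor of `Z₂` is redirected to the junction. -/
theorem red_self (u : V₁) (a₂ : V₂) : red u a₂ a₂ = Sum.inl u := by
  unfold red
  rw [if_pos rfl]

/-- Another vertex of `Z₂` stays. -/
theorem red_of_ne (u : V₁) {a₂ x : V₂} (h : x ≠ a₂) : red u a₂ x = Sum.inr x := by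
  unfold red
  rw [if_neg h]

/-- A redirected vertex is a `Z₁`-vertex only as the junction. -/
theorem eq_of_red_eq_inl {u : V₁} {a₂ x : V₂} {v : V₁} (h : red u a₂ x = Sum.inl v) : x = a₂ ∧ v = u := by
  by_cases hx : x = a₂
  · rw [hx, red_self] at h
    exact ⟨hx, (Sum.inl.inj h).symm⟩
  · rw [red_of_ne u hx] at h
    exact absurd h (by simp)

/-- A redirected vertex is a `Z₂`-vertex only if it is not the anchor. -/
theorem eq_of_red_eq_inr {u : V₁} {a₂ x y : V₂} (h : red u a₂ x = Sum.inr y) : x ≠ a₂ ∧ x = y := by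
  by_cases hx : x = a₂
  · rw [hx, red_self] at h
    exact absurd h (by simp)
  · rw [red_of_ne u hx] at h
    exact ⟨hx, Sum.inr.inj h⟩

variable (Z₁ : ZoneData V₁ E₁ U₁ U₂) (u : V₁) (Z₂ : ZoneData V₂ E₂ T₁ T₂) (a₂ : V₂)

/-- THE PENDANT ATTACHMENT: the unmarked multigraph `Z₁` with the zone `Z₂` hung at `u` (its anchor `a₂` identified
with `u`; the marks of `Z₁` are dropped, the marks of `Z₂` redirected). -/
noncomputable def pendant : ZoneData (V₁ ⊕ V₂) (E₁ ⊕ E₂) T₁ T₂ where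
  fst := Sum.elim (fun e => Sum.inl (Z₁.fst e)) (fun e => red u a₂ (Z₂.fst e))
  snd := Sum.elim (fun e => Sum.inl (Z₁.snd e)) (fun e => red u a₂ (Z₂.snd e))
  at₁ := fun t => red u a₂ (Z₂.at₁ t)
  at₂ := fun t => red u a₂ (Z₂.at₂ t)

/-- The colouring of `Z₁` in a state of the glued zone. -/
def colL (σ : State (E₁ ⊕ E₂) T₁ T₂) : E₁ → Bool := fun e => σ.1 (Sum.inl e)

/-- The state of `Z₂` in a state of the glued zone. -/
def restr (σ : State (E₁ ⊕ E₂) T₁ T₂) : State E₂ T₁ T₂ := (fun e => σ.1 (Sum.inr e), σ.2.1, σ.2.2)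

/-! ## Adjacency of a colouring (either colour) -/

/-- Adjacency through an edge of colour `c` under the colouring `ω`. -/
def cAdj {V E T₁' T₂' : Type*} (Z : ZoneData V E T₁' T₂') (c : Bool) (ω : E → Bool) (x y : V) : Prop :=
  ∃ e, Z.Joins e x y ∧ ω e = c

/-- The adjacency of a state of colour `c` is that of its colouring. -/
theorem adj_eq_cAdj {V E T₁' T₂' : Type*} (Z : ZoneData V E T₁' T₂') (c : Bool) (σ : State E T₁' T₂') :
    Z.Adj (fun _ b => b = c) σ = cAdj Z c σ.1 := rfl

/-- Blue adjacency of a colouring. -/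
theorem cAdj_false {V E T₁' T₂' : Type*} (Z : ZoneData V E T₁' T₂') (ω : E → Bool) :
    cAdj Z false ω = Z.BlueAdjE ω := rfl

/-- Red adjacency of a colouring. -/
theorem cAdj_true {V E T₁' T₂' : Type*} (Z : ZoneData V E T₁' T₂') (ω : E → Bool) :
    cAdj Z true ω = Z.RedAdjE ω := rfl

/-- The adjacency of a colouring is symmetric. -/
theorem cAdj_symm {V E T₁' T₂' : Type*} (Z : ZoneData V E T₁' T₂') (c : Bool) (ω : E → Bool) :
    ∀ x y, cAdj Z c ω x y → cAdj Z c ω y x :=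
  fun _ _ ⟨e, he, hc⟩ => ⟨e, he.symm, hc⟩

variable (c : Bool) (σ : State (E₁ ⊕ E₂) T₁ T₂)

/-- An adjacency of `Z₁` lifts to the glued zone. -/
theorem adj_of_left {v v' : V₁} (h : cAdj Z₁ c (colL σ) v v') :
    cAdj (pendant Z₁ u Z₂ a₂) c σ.1 (Sum.inl v) (Sum.inl v') := by
  obtain ⟨e, he, hc⟩ := h
  refine ⟨Sum.inl e, ?_, hc⟩
  rcases he with ⟨rfl, rfl⟩ | ⟨rfl, rfl⟩
  · exact Or.inl ⟨rfl, rfl⟩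
  · exact Or.inr ⟨rfl, rfl⟩

/-- An adjacency of `Z₂` lifts to the glued zone (through the redirection). -/
theorem adj_of_right {x y : V₂} (h : cAdj Z₂ c (restr σ).1 x y) :
    cAdj (pendant Z₁ u Z₂ a₂) c σ.1 (red u a₂ x) (red u a₂ y) := by
  obtain ⟨e, he, hc⟩ := h
  refine ⟨Sum.inr e, ?_, hc⟩
  rcases he with ⟨rfl, rfl⟩ | ⟨rfl, rfl⟩
  · exact Or.inl ⟨rfl, rfl⟩
  · exact Or.inr ⟨rfl, rfl⟩

/-- A path of `Z₁` lifts. -/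
theorem reflTransGen_of_left {v v' : V₁} (h : Relation.ReflTransGen (cAdj Z₁ c (colL σ)) v v') :
    Relation.ReflTransGen (cAdj (pendant Z₁ u Z₂ a₂) c σ.1) (Sum.inl v) (Sum.inl v') := by
  induction h with
  | refl => exact Relation.ReflTransGen.refl
  | tail _ h ih => exact ih.tail (adj_of_left Z₁ u Z₂ a₂ c σ h)

/-- A path of `Z₂` lifts. -/
theorem reflTransGen_of_right {x y : V₂} (h : Relation.ReflTransGen (cAdj Z₂ c (restr σ).1) x y) :
    Relation.ReflTransGen (cAdj (pendant Z₁ u Z₂ a₂) c σ.1) (red u a₂ x) (red u a₂ y) := by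
  induction h with
  | refl => exact Relation.ReflTransGen.refl
  | tail _ h ih => exact ih.tail (adj_of_right Z₁ u Z₂ a₂ c σ h)

/-! ## The reach of the glued zone, read off the two sides -/

/-- The `Z₁`-part of a vertex set of the glued zone. -/
def leftSet (S : Set (V₁ ⊕ V₂)) : Set V₁ := {v | Sum.inl v ∈ S}

/-- The `Z₂`-part of a vertex set of the glued zone. -/
def rightSet (S : Set (V₁ ⊕ V₂)) : Set V₂ := {x | Sum.inr x ∈ S}

/-- THE JUNCTION CONDITION: `inl u` is reached from `S` — `u` from the left part inside `Z₁`, or `a₂` from the right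
part inside `Z₂`. -/
def junction (S : Set (V₁ ⊕ V₂)) : Prop :=
  u ∈ reach (cAdj Z₁ c (colL σ)) (leftSet S) ∨ a₂ ∈ reach (cAdj Z₂ c (restr σ).1) (rightSet S)

/-- The candidate reach condition, vertex by vertex. -/
def reachCond (S : Set (V₁ ⊕ V₂)) : V₁ ⊕ V₂ → Prop
  | Sum.inl v => v ∈ reach (cAdj Z₁ c (colL σ)) (leftSet S) ∨
      (junction Z₁ u Z₂ a₂ c σ S ∧ v ∈ reach (cAdj Z₁ c (colL σ)) {u})
  | Sum.inr x => x ≠ a₂ ∧ (x ∈ reach (cAdj Z₂ c (restr σ).1) (rightSet S) ∨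
      (junction Z₁ u Z₂ a₂ c σ S ∧ x ∈ reach (cAdj Z₂ c (restr σ).1) {a₂}))

/-- The reach condition at the junction is the junction condition. -/
theorem reachCond_inl_u_iff (S : Set (V₁ ⊕ V₂)) :
    reachCond Z₁ u Z₂ a₂ c σ S (Sum.inl u) ↔ junction Z₁ u Z₂ a₂ c σ S := by
  simp only [reachCond]
  constructor
  · rintro (h | ⟨h, -⟩)
    · exact Or.inl h
    · exact h
  · intro h
    exact Or.inr ⟨h, mem_reach_of_mem rfl⟩

/-- The reach condition at a redirected vertex of `Z₂`. -/
theorem reachCond_red_iff (S : Set (V₁ ⊕ V₂)) (x : V₂) :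
    reachCond Z₁ u Z₂ a₂ c σ S (red u a₂ x) ↔
      x ∈ reach (cAdj Z₂ c (restr σ).1) (rightSet S) ∨
        (junction Z₁ u Z₂ a₂ c σ S ∧ x ∈ reach (cAdj Z₂ c (restr σ).1) {a₂}) := by
  by_cases hx : x = a₂
  · subst hx
    rw [red_self, reachCond_inl_u_iff]
    constructor
    · intro h
      exact Or.inr ⟨h, mem_reach_of_mem rfl⟩
    · rintro (h | ⟨h, -⟩)
      · exact Or.inr h
      · exact h
  · rw [red_of_ne u hx]
    simp only [reachCond, ne_eq, hx, not_false_eq_true, true_and]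

/-- The reach condition is closed under the lifted adjacencies of `Z₂`. -/
theorem reachCond_tail_right (S : Set (V₁ ⊕ V₂)) {x y : V₂} (hx : reachCond Z₁ u Z₂ a₂ c σ S (red u a₂ x))
    (h : cAdj Z₂ c (restr σ).1 x y) : reachCond Z₁ u Z₂ a₂ c σ S (red u a₂ y) := by
  rw [reachCond_red_iff] at hx ⊢
  rcases hx with hx | ⟨hj, hx⟩
  · exact Or.inl (reach_tail hx h)
  · exact Or.inr ⟨hj, reach_tail hx h⟩

/-- The reach condition is closed under the lifted adjacencies of `Z₁`. -/
theorem reachCond_tail_left (S : Set (V₁ ⊕ V₂)) {v v' : V₁} (hv : reachCond Z₁ u Z₂ a₂ c σ S (Sum.inl v))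
    (h : cAdj Z₁ c (colL σ) v v') : reachCond Z₁ u Z₂ a₂ c σ S (Sum.inl v') := by
  simp only [reachCond] at hv ⊢
  rcases hv with hv | ⟨hj, hv⟩
  · exact Or.inl (reach_tail hv h)
  · exact Or.inr ⟨hj, reach_tail hv h⟩

/-- The reach condition holds on the reach (for a source set avoiding the stray vertex). -/
theorem reachCond_of_mem_reach (S : Set (V₁ ⊕ V₂)) (hS : Sum.inr a₂ ∉ S) {w : V₁ ⊕ V₂}
    (hw : w ∈ reach (cAdj (pendant Z₁ u Z₂ a₂) c σ.1) S) : reachCond Z₁ u Z₂ a₂ c σ S w := by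
  refine reach_subset_of_closed (U := {w | reachCond Z₁ u Z₂ a₂ c σ S w}) ?_ ?_ hw
  · intro w hwS
    rcases w with v | x
    · exact Or.inl (mem_reach_of_mem hwS)
    · refine ⟨fun hx => hS (hx ▸ hwS), Or.inl (mem_reach_of_mem hwS)⟩
  · rintro w w' hw ⟨e, he, hc⟩
    rcases e with e | e
    · simp only [Joins, pendant, Sum.elim_inl] at he
      rcases he with ⟨rfl, rfl⟩ | ⟨rfl, rfl⟩
      · exact reachCond_tail_left Z₁ u Z₂ a₂ c σ S hw ⟨e, Or.inl ⟨rfl, rfl⟩, hc⟩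
      · exact reachCond_tail_left Z₁ u Z₂ a₂ c σ S hw ⟨e, Or.inr ⟨rfl, rfl⟩, hc⟩
    · simp only [Joins, pendant, Sum.elim_inr] at he
      rcases he with ⟨rfl, rfl⟩ | ⟨rfl, rfl⟩
      · exact reachCond_tail_right Z₁ u Z₂ a₂ c σ S hw ⟨e, Or.inl ⟨rfl, rfl⟩, hc⟩
      · exact reachCond_tail_right Z₁ u Z₂ a₂ c σ S hw ⟨e, Or.inr ⟨rfl, rfl⟩, hc⟩

/-- A vertex of `Z₂` reached inside `Z₂` from the right part of `S` is reached in the glued zone. -/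
theorem red_mem_reach_of_right (S : Set (V₁ ⊕ V₂)) (hS : Sum.inr a₂ ∉ S) {x : V₂}
    (h : x ∈ reach (cAdj Z₂ c (restr σ).1) (rightSet S)) :
    red u a₂ x ∈ reach (cAdj (pendant Z₁ u Z₂ a₂) c σ.1) S := by
  obtain ⟨s, hs, hsx⟩ := h
  have hsa : s ≠ a₂ := fun h => hS (h ▸ hs)
  refine ⟨red u a₂ s, ?_, reflTransGen_of_right Z₁ u Z₂ a₂ c σ hsx⟩
  rw [red_of_ne u hsa]
  exact hs

/-- A vertex of `Z₁` reached inside `Z₁` from the left part of `S` is reached in the glued zone. -/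
theorem inl_mem_reach_of_left (S : Set (V₁ ⊕ V₂)) {v : V₁} (h : v ∈ reach (cAdj Z₁ c (colL σ)) (leftSet S)) :
    Sum.inl v ∈ reach (cAdj (pendant Z₁ u Z₂ a₂) c σ.1) S := by
  obtain ⟨s, hs, hsv⟩ := h
  exact ⟨Sum.inl s, hs, reflTransGen_of_left Z₁ u Z₂ a₂ c σ hsv⟩

/-- The junction condition puts the junction in the reach. -/
theorem inl_u_mem_reach_of_junction (S : Set (V₁ ⊕ V₂)) (hS : Sum.inr a₂ ∉ S)
    (h : junction Z₁ u Z₂ a₂ c σ S) : Sum.inl u ∈ reach (cAdj (pendant Z₁ u Z₂ a₂) c σ.1) S := by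
  rcases h with h | h
  · exact inl_mem_reach_of_left Z₁ u Z₂ a₂ c σ S h
  · have := red_mem_reach_of_right Z₁ u Z₂ a₂ c σ S hS h
    rwa [red_self] at this

/-- The reach condition puts the vertex in the reach. -/
theorem mem_reach_of_reachCond (S : Set (V₁ ⊕ V₂)) (hS : Sum.inr a₂ ∉ S) {w : V₁ ⊕ V₂}
    (hw : reachCond Z₁ u Z₂ a₂ c σ S w) : w ∈ reach (cAdj (pendant Z₁ u Z₂ a₂) c σ.1) S := by
  rcases w with v | x
  · simp only [reachCond] at hw
    rcases hw with hv | ⟨hj, hv⟩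
    · exact inl_mem_reach_of_left Z₁ u Z₂ a₂ c σ S hv
    · obtain ⟨s, hs, hsv⟩ := hv
      rw [Set.mem_singleton_iff] at hs
      rw [hs] at hsv
      exact reach_trans (inl_u_mem_reach_of_junction Z₁ u Z₂ a₂ c σ S hS hj)
        (reflTransGen_of_left Z₁ u Z₂ a₂ c σ hsv)
  · obtain ⟨hx, hw⟩ := hw
    rcases hw with hw | ⟨hj, hw⟩
    · have := red_mem_reach_of_right Z₁ u Z₂ a₂ c σ S hS hw
      rwa [red_of_ne u hx] at this
    · obtain ⟨s, hs, hsx⟩ := hw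
      rw [Set.mem_singleton_iff] at hs
      rw [hs] at hsx
      have h2 := reflTransGen_of_right Z₁ u Z₂ a₂ c σ hsx
      rw [red_self, red_of_ne u hx] at h2
      exact reach_trans (inl_u_mem_reach_of_junction Z₁ u Z₂ a₂ c σ S hS hj) h2

/-- **A `Z₁`-vertex is reached** iff it is reached inside `Z₁` from the left part of `S`, or connected to `u`
inside `Z₁` with the junction reached. -/
theorem inl_mem_reach_iff (S : Set (V₁ ⊕ V₂)) (hS : Sum.inr a₂ ∉ S) (v : V₁) :
    Sum.inl v ∈ reach (cAdj (pendant Z₁ u Z₂ a₂) c σ.1) S ↔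
      v ∈ reach (cAdj Z₁ c (colL σ)) (leftSet S) ∨
        (junction Z₁ u Z₂ a₂ c σ S ∧ v ∈ reach (cAdj Z₁ c (colL σ)) {u}) :=
  ⟨fun h => reachCond_of_mem_reach Z₁ u Z₂ a₂ c σ S hS h,
    fun h => mem_reach_of_reachCond Z₁ u Z₂ a₂ c σ S hS (w := Sum.inl v) h⟩

/-- **A `Z₂`-vertex is reached** iff it is not the stray vertex and is reached inside `Z₂` from the right part of
`S`, or connected to `a₂` inside `Z₂` with the junction reached. -/
theorem inr_mem_reach_iff (S : Set (V₁ ⊕ V₂)) (hS : Sum.inr a₂ ∉ S) (x : V₂) :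
    Sum.inr x ∈ reach (cAdj (pendant Z₁ u Z₂ a₂) c σ.1) S ↔
      x ≠ a₂ ∧ (x ∈ reach (cAdj Z₂ c (restr σ).1) (rightSet S) ∨
        (junction Z₁ u Z₂ a₂ c σ S ∧ x ∈ reach (cAdj Z₂ c (restr σ).1) {a₂})) :=
  ⟨fun h => reachCond_of_mem_reach Z₁ u Z₂ a₂ c σ S hS h,
    fun h => mem_reach_of_reachCond Z₁ u Z₂ a₂ c σ S hS (w := Sum.inr x) h⟩

end Pendant

end ZoneZ

end PercRepro
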